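import Mathlib
import HarnessLib

/-!
# Route `IntegerScrew` — the GENERATOR of the truncated multiplicative walk as a matrix on `{1,…,M}`, and its
# arithmetic form (PIVOT-LAW 13.10 PROP. N4 / CONTINUUM-LIMIT 16.1, 16.4)

PROP. N4 (PIVOT-LAW §13.10; tree: `IntegerScrewVonMangoldtCouplingDirichletForm`) identifies the von Mangoldt
coupling matrix with `(log M − γ₀)I + ℒ_M + ℰ_M`, `ℒ_M` the generator of the reversible random multiplicative walk
on `{1,…,M}`: `k → kn` at rate `Λ(n)/n` (`kn ≤ M`), `k → k/n` at rate `Λ(n)` (`n ∣ k`).  THEOREM C♯ (§13.44)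
runs this walk in `τ`-time (`τ = t·log M`, rates divided by `L = log M`).  This file types that `τ`-time
generator as a MATRIX on the finite state type `St M = {1,…,M}` — the object to which the Markov transfer lemma
(`IntegerScrewMarkovTransfer`) applies — and proves the two facts the skeleton of THEOREM C♯ needs:

* `walkGen M` is a Metzler matrix (`walkGen_offdiag_nonneg`) acting as `(Qg)(k) = Σ_j rate(k,j)(g j − g k)`
  (`walkGen_sum_eq`);
* **`walkGen_sum_eq_arith`**: `Σ_j walkGen(k,j)·g(j) = Σ_{n ≤ M/k} Λ(n)/(nL)·(g(kn) − g(k)) + Σ_{d ∣ k} Λ(d)/L·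
  (g(k/d) − g(k))` — births reindexed by `n = j/k` (`sum_birthRate_eq`), deaths by `d = k/j` over the divisors
  of `k` (`sum_deathRate_eq`); the terms `n = 1`, `d = 1` vanish with `Λ(1) = 0` and `Λ` kills every `n`, `d`
  that is not a prime power — this is the form `𝒜_D g(x) = Σ_{xn ≤ M}(Λ(n)/(nL))[g(xn) − g(x)] +
  Σ_{n ∣ x}(Λ(n)/L)[g(x/n) − g(x)]` in which CONTINUUM-LIMIT 16.1/16.4 are written.

Elementary (Finset reindexing); RH-free.  Nothing here bears on the truth of RH.  References: PIVOT-LAW §13.10,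
§13.44; CONTINUUM-LIMIT §16.1, §16.4 (rh-explicit); M. Suzuki, J. Lond. Math. Soc. (2) 108 (2023) 1448–1487
[Suzuki2023].
-/

noncomputable section

-- D-0017: `Summit.<S>.<S>.…` is the designed namespace of a single-problem summit.
set_option linter.dupNamespace false

namespace Summit.RiemannHypothesis.RiemannHypothesis.Theorems.IntegerScrew

open Finset ArithmeticFunction

/-! ## The generator -/

/-- τ-time jump rate of the truncated multiplicative walk from `k` to `j ≠ k` (`L = log M`): `Λ(j/k)/((j/k)·L)`
if `k ∣ j` (a birth `k → kn`, `n = j/k`), `Λ(k/j)/L` if `j ∣ k` (a death), `0` otherwise — and `Λ` kills every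
`n` that is not a prime power. -/
def walkRate (L : ℝ) (k j : ℕ) : ℝ :=
  if k = j then 0
  else if k ∣ j then (Λ (j / k) : ℝ) / (((j / k : ℕ) : ℝ) * L)
  else if j ∣ k then (Λ (k / j) : ℝ) / L
  else 0

/-- No jump from a state to itself. -/
theorem walkRate_self (L : ℝ) (k : ℕ) : walkRate L k k = 0 := by
  simp [walkRate]

/-- Rates are non-negative (`Λ ≥ 0`, `L ≥ 0`). -/
theorem walkRate_nonneg {L : ℝ} (hL : 0 ≤ L) (k j : ℕ) : 0 ≤ walkRate L k j := by
  unfold walkRate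
  split_ifs
  · exact le_rfl
  · exact div_nonneg vonMangoldt_nonneg (by positivity)
  · exact div_nonneg vonMangoldt_nonneg hL
  · exact le_rfl

/-- The state space `{1, …, M}`. -/
abbrev St (M : ℕ) : Type := ↥(Finset.Icc 1 M)

/-- The τ-time GENERATOR of the truncated multiplicative walk on `{1,…,M}` (PROP. N4, rates divided by
`L = log M`), as a matrix: off-diagonal entries `walkRate`, diagonal `−Σ` of the row. -/
def walkGen (M : ℕ) : Matrix (St M) (St M) ℝ := fun k j =>
  if k = j then -∑ j' : St M, walkRate (Real.log M) k j' else walkRate (Real.log M) k j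

/-- `walkGen` is a Metzler matrix. -/
theorem walkGen_offdiag_nonneg (M : ℕ) : ∀ i j : St M, i ≠ j → 0 ≤ walkGen M i j := by
  intro i j hij
  simp only [walkGen, if_neg hij]
  exact walkRate_nonneg (Real.log_natCast_nonneg M) _ _

/-- The generator acts as `(Qg)(k) = Σ_j rate(k,j)·(g j − g k)`. -/
theorem walkGen_sum_eq (M : ℕ) (g : St M → ℝ) (k : St M) :
    ∑ j : St M, walkGen M k j * g j =
      ∑ j : St M, walkRate (Real.log M) (k : ℕ) (j : ℕ) * (g j - g k) := by
  have h : ∀ j : St M, walkGen M k j * g j =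
      walkRate (Real.log M) (k : ℕ) (j : ℕ) * g j +
        (if k = j then -(∑ j' : St M, walkRate (Real.log M) (k : ℕ) (j' : ℕ)) * g j else 0) := by
    intro j
    by_cases hkj : k = j
    · subst hkj
      simp [walkGen, walkRate_self]
    · simp [walkGen, hkj]
  simp_rw [h, Finset.sum_add_distrib, Finset.sum_ite_eq, Finset.mem_univ, if_true, mul_sub,
    Finset.sum_sub_distrib, ← Finset.sum_mul]
  ring

/-! ## The generator in arithmetic form: births over `n ≤ M/k`, deaths over the divisors of `k` -/

/-- Birth part of the rate: `Λ(j/k)/((j/k)L)` if `k ∣ j` (vanishes at `j = k` since `Λ(1) = 0`). -/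
def birthRate (L : ℝ) (k j : ℕ) : ℝ :=
  if k ∣ j then (Λ (j / k) : ℝ) / (((j / k : ℕ) : ℝ) * L) else 0

/-- Death part of the rate: `Λ(k/j)/L` if `j ∣ k` (vanishes at `j = k`). -/
def deathRate (L : ℝ) (k j : ℕ) : ℝ :=
  if j ∣ k then (Λ (k / j) : ℝ) / L else 0

/-- `rate = birth part + death part` (the two supports meet only at `j = k`, where both vanish). -/
theorem walkRate_eq_birth_add_death (L : ℝ) {k : ℕ} (hk : k ≠ 0) (j : ℕ) :
    walkRate L k j = birthRate L k j + deathRate L k j := by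
  unfold walkRate birthRate deathRate
  by_cases hkj : k = j
  · subst hkj
    simp [Nat.div_self (Nat.pos_of_ne_zero hk)]
  · rw [if_neg hkj]
    by_cases h1 : k ∣ j
    · have h2 : ¬ j ∣ k := fun h => hkj (Nat.dvd_antisymm h1 h)
      simp [h1, h2]
    · by_cases h2 : j ∣ k
      · simp [h1, h2]
      · simp [h1, h2]

/-- Births reindexed by `n = j/k`: `{j ≤ M : k ∣ j} = {kn : n ≤ M/k}`. -/
theorem sum_birthRate_eq (L : ℝ) {M k : ℕ} (hk : 1 ≤ k) (F : ℕ → ℝ) :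
    ∑ j ∈ Finset.Icc 1 M, birthRate L k j * F j =
      ∑ n ∈ Finset.Icc 1 (M / k), (Λ n : ℝ) / ((n : ℝ) * L) * F (k * n) := by
  have hk0 : k ≠ 0 := by omega
  unfold birthRate
  rw [← Finset.sum_filter_add_sum_filter_not (Finset.Icc 1 M) (fun j => k ∣ j)]
  have hzero : ∑ j ∈ (Finset.Icc 1 M).filter (fun j => ¬ k ∣ j),
      (if k ∣ j then (Λ (j / k) : ℝ) / (((j / k : ℕ) : ℝ) * L) else 0) * F j = 0 := by
    refine Finset.sum_eq_zero fun j hj => ?_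
    rw [Finset.mem_filter] at hj
    rw [if_neg hj.2, zero_mul]
  rw [hzero, add_zero]
  have hset : (Finset.Icc 1 M).filter (fun j => k ∣ j) =
      (Finset.Icc 1 (M / k)).map ⟨fun n => k * n, mul_right_injective₀ hk0⟩ := by
    ext j
    simp only [Finset.mem_filter, Finset.mem_Icc, Finset.mem_map, Function.Embedding.coeFn_mk]
    constructor
    · rintro ⟨⟨h1, h2⟩, ⟨n, rfl⟩⟩
      refine ⟨n, ⟨?_, ?_⟩, rfl⟩
      · rcases Nat.eq_zero_or_pos n with h | h
        · subst h; simp at h1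
        · exact h
      · exact (Nat.le_div_iff_mul_le hk).2 (by rw [mul_comm]; exact h2)
    · rintro ⟨n, ⟨h1, h2⟩, rfl⟩
      refine ⟨⟨?_, ?_⟩, dvd_mul_right k n⟩
      · have hn : n ≠ 0 := by omega
        exact Nat.one_le_iff_ne_zero.2 (Nat.mul_ne_zero hk0 hn)
      · have := (Nat.le_div_iff_mul_le hk).1 h2
        rw [mul_comm] at this
        exact this
  rw [hset, Finset.sum_map]
  refine Finset.sum_congr rfl fun n hn => ?_
  simp only [Function.Embedding.coeFn_mk]
  rw [if_pos (dvd_mul_right k n), Nat.mul_div_cancel_left n (by omega)]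

/-- Deaths reindexed by `d = k/j` over the divisors of `k` (`k ≤ M`). -/
theorem sum_deathRate_eq (L : ℝ) {M k : ℕ} (hk : 1 ≤ k) (hkM : k ≤ M) (F : ℕ → ℝ) :
    ∑ j ∈ Finset.Icc 1 M, deathRate L k j * F j =
      ∑ d ∈ k.divisors, (Λ d : ℝ) / L * F (k / d) := by
  have hk0 : k ≠ 0 := by omega
  unfold deathRate
  rw [← Finset.sum_filter_add_sum_filter_not (Finset.Icc 1 M) (fun j => j ∣ k)]
  have hzero : ∑ j ∈ (Finset.Icc 1 M).filter (fun j => ¬ j ∣ k),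
      (if j ∣ k then (Λ (k / j) : ℝ) / L else 0) * F j = 0 := by
    refine Finset.sum_eq_zero fun j hj => ?_
    rw [Finset.mem_filter] at hj
    rw [if_neg hj.2, zero_mul]
  rw [hzero, add_zero]
  have hset : (Finset.Icc 1 M).filter (fun j => j ∣ k) = k.divisors := by
    ext j
    simp only [Finset.mem_filter, Finset.mem_Icc, Nat.mem_divisors]
    constructor
    · rintro ⟨_, h⟩; exact ⟨h, hk0⟩
    · rintro ⟨h, _⟩
      exact ⟨⟨Nat.pos_of_dvd_of_pos h (by omega), (Nat.le_of_dvd (by omega) h).trans hkM⟩, h⟩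
  rw [hset]
  have hcongr : ∑ j ∈ k.divisors, (if j ∣ k then (Λ (k / j) : ℝ) / L else 0) * F j =
      ∑ j ∈ k.divisors, (Λ (k / j) : ℝ) / L * F j := by
    refine Finset.sum_congr rfl fun j hj => ?_
    rw [if_pos (Nat.mem_divisors.1 hj).1]
  rw [hcongr, ← Nat.sum_div_divisors k (fun d => (Λ d : ℝ) / L * F (k / d))]
  refine Finset.sum_congr rfl fun j hj => ?_
  rw [Nat.div_div_self (Nat.mem_divisors.1 hj).1 hk0]

/-- **The generator in the arithmetic form of CONTINUUM-LIMIT 16.1/16.4**: for `g : ℕ → ℝ` and a state `k`,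
`Σ_j walkGen(k,j)·g(j) = Σ_{n ≤ M/k} Λ(n)/(nL)·(g(kn) − g(k)) + Σ_{d ∣ k} Λ(d)/L·(g(k/d) − g(k))`
(births `k → kn`, deaths `k → k/d`; the terms `n = 1`, `d = 1` vanish since `Λ(1) = 0`, and `Λ` kills the
`n`, `d` that are not prime powers). -/
theorem walkGen_sum_eq_arith (M : ℕ) (g : ℕ → ℝ) (k : St M) :
    ∑ j : St M, walkGen M k j * g j =
      (∑ n ∈ Finset.Icc 1 (M / k), (Λ n : ℝ) / ((n : ℝ) * Real.log M) * (g (k * n) - g k)) +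
        ∑ d ∈ (k : ℕ).divisors, (Λ d : ℝ) / Real.log M * (g (k / d) - g k) := by
  have hk : 1 ≤ (k : ℕ) := (Finset.mem_Icc.1 k.2).1
  have hkM : (k : ℕ) ≤ M := (Finset.mem_Icc.1 k.2).2
  rw [walkGen_sum_eq M (fun j => g j) k]
  have h1 : ∑ j : St M, walkRate (Real.log M) (k : ℕ) (j : ℕ) * (g j - g k) =
      ∑ j ∈ Finset.Icc 1 M, walkRate (Real.log M) (k : ℕ) j * (g j - g k) :=
    Finset.sum_coe_sort (Finset.Icc 1 M) (fun j => walkRate (Real.log M) (k : ℕ) j * (g j - g k))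
  rw [h1]
  simp_rw [walkRate_eq_birth_add_death (Real.log M) (show (k : ℕ) ≠ 0 by omega), add_mul,
    Finset.sum_add_distrib]
  rw [sum_birthRate_eq (Real.log M) hk (fun j => g j - g k),
    sum_deathRate_eq (Real.log M) hk hkM (fun j => g j - g k)]

end Summit.RiemannHypothesis.RiemannHypothesis.Theorems.IntegerScrew

end
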